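import Summits.BirchSwinnertonDyer.BirchSwinnertonDyer.Theorems.QuadraticBranchSignedControlPlusKatoDivisibilityThm12OfColemanKato
import Summits.BirchSwinnertonDyer.BirchSwinnertonDyer.Theorems.QuadraticBranchSignedControlPlusKatoDivisibilityOfEulerSystemBoundLeaf
import Literature.NumberTheory.EllipticCurves.Kobayashi2003.SignedSelmerTorsionOfColemanKatoProofs
import HarnessLib

/-!
# K8 item 19241 `PlusKatoDivisibilityBranch` on Coleman packages ONLY: (RK⁺) row by row with Kobayashi
# Thm. 1.2 as a ROW hypothesis, the route decl on every tower-onto row from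
# `{η-package with Euler-system pin, η = 1 Coleman/Kato package, Kato Thm. 13.4, period unit}`, and the
# rung leaf `O5SharpGss` re-run on that input

Cell `bsd-potss` (HOME `run/shared/lean/pub/bsd-potss/`), seat `bsd-potss-k8q-c2x` g3 (prover; WIDTH-LEVER
second lane of item stmt-BirchSwinnertonDyer-19241 `PlusKatoDivisibilityBranch`, rung K8-Gss2, route
`QuadraticBranchSignedControl`). HONEST FRAMING: the programme assembles BSD for analytic rank `≤ 1`
strictly from published theorems and types the remainder; BSD is not proved by any of this; every theorem
below is CONDITIONAL on named Literature facts displayed as hypotheses (`hZ` =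
`Kobayashi2003.thm62_63_73_etaColemanPoitouTate_zeta`, `hCK` = `Kobayashi2003.thm62_63_73_signedColemanKato_zeta`,
`h134` = `Kato2004.thm13_4_lengthAt_fineSelmerDual_le_of_isEulerSystemClass`, `h5` =
`realPeriodRat_eq_unit_mul_plusPeriod`); the item stays settled-by-citation; nothing closes.

Sibling of this seat's `…PlusKatoDivisibilityThm12OfColemanKato` (Kobayashi Thm. 1.2 in the kernel on the
tower-onto rows from `{hCK, h134, h5}`) and of g2's `…OfEulerSystemBound{,Rows,Leaf}`:
* §5 `ColemanKatoTorsion.quadraticBranchPlusKatoDivisibilityAt_of_zeta_of_thm13_4_of_row` — g2's (RK⁺)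
  row theorem with the named fact `h12` (Kobayashi Thm. 1.2) replaced by its CONTENT on the row (any
  source plugs in; g2's `…_of_thm12` is the instance `h12V := h12 …`); `…_of_colemanPackages_of_onto` and
  `plusKatoDivisibilityBranch_onto_of_colemanPackages` — **the route decl `PlusKatoDivisibilityBranch`
  RESTRICTED TO THE TOWER-ONTO ROWS (= the rows on which `closes` consumes it) from `{hZ, hCK, h134, h5}`**,
  i.e. from two Coleman / Poitou–Tate construction packages (`η` and `1`, both with genuine Euler-system
  pins), Kato's reduction-free Euler-system bound and the period unit — NO Kobayashi theorem (1.2 / 2.2 /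
  4.1) among the hypotheses;
* §6 `ColemanKatoTorsion.o5SharpGss_of_colemanPackages_of_cruxes` — the rung leaf K8 `O5SharpGss` from
  those four facts + the route's genuinely OPEN cruxes `hE` (19242), `hN` (19243), `h₄` (19116) + the held
  inputs `hP`, `hKO`, `hR`, with `hK` (19241), `h₂` (19115) and `hG` (Gss2Assembly) discharged by name.
* §7 the SECOND road (class-wide): with this seat's Literature theorem
  `Kobayashi2003.thm12_signedSelmerDual_finite_torsion_of_colemanKato` (Thm. 1.2 ⟸ `hCK` + Kato (12.2.2)
  `hH1` + Kato 12.4 (1)∘(17.13.1) `hYt` + modularity `hmod`), g2's onto chain, g2's leaf, and g0's ∀-ROW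
  derivation of the item decl (`plusKatoDivisibilityBranch_of_etaKatoColemanPoitouTate_of_thm12`) all run
  with `h12` DISCHARGED — `plusKatoDivisibilityBranch_of_packages`: **the item decl
  `PlusKatoDivisibilityBranch` on ALL rows (CM and non-onto included) from `{thm52_62_63_73_etaKatoColeman
  PoitouTate, hCK, hH1, hYt, hmod}`, no Kobayashi theorem (1.2 / 2.2 / 4.1) among the hypotheses.**
NOT covered (honest): no `_holds` for any package; every statement is conditional.

References: [Kobayashi2003] Thm. 1.2 (p. 2), Thm. 2.2 (p. 5), Thm. 4.1 (p. 8), Thm. 6.2–6.3 (p. 11),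
Cor. 7.2, Thm. 7.3, proof of Thm. 7.4 (pp. 12–13); [Kato2004Asterisque] Thm. 12.6 (p. 222), (12.5.2),
Thm. 13.4 (p. 226); [GreenbergVatsal2000] §3 Remark 3.4; [GreenbergLNM1716] §3 (descent; reading).
-/

noncomputable section

set_option linter.dupNamespace false

open scoped Classical

open CongruenceSubgroup Field WeierstrassCurve
open Literature.NumberTheory.EllipticCurves
open Literature.NumberTheory.EllipticCurves.ModularForms
open Literature.NumberTheory.EllipticCurves.Module
open Literature.NumberTheory.GaloisRepresentations

namespace Summit.BirchSwinnertonDyer.BirchSwinnertonDyer.Theorems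

/-! ## §5 (RK⁺) row by row with Thm. 1.2 as a ROW hypothesis; the onto rows and the rung leaf from
`{hZ, hCK, h134, h5}` -/

namespace ColemanKatoTorsion

open Summit.BirchSwinnertonDyer.Rank1Residual.Additive hiding EtaSignedSelmerDualData
open Summit.BirchSwinnertonDyer.Rank1Residual.Additive.SignedTwist
open Summit.BirchSwinnertonDyer.BirchSwinnertonDyer.Theses.QuadraticBranchSignedControl

section RK

variable {p : ℕ} [Fact p.Prime]

/-- **(RK⁺) for ONE curve `V` from `{hZ, h134}` + Kobayashi Thm. 1.2 as a ROW-LEVEL hypothesis** —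
g2's `EulerSystemBound.quadraticBranchPlusKatoDivisibilityAt_of_zeta_of_thm13_4_of_thm12` VERBATIM with
the named fact `h12` replaced by its content on the row `(V, p)` (`h12V`: every plus dual datum of
`Sel⁺(V/ℚ_∞)` at a cyclotomic pin matching the variable, given a newform of `V`, is finitely generated
`Λ`-torsion), so that ANY source of Thm. 1.2 on the row can be plugged in (the named fact; §4 of this
seat's `…Thm12OfColemanKato`; a future `_holds`). Proof = g0's assembly (`exists_etaDatum_prod_linearEquiv
_of_decomposition`, `Char(X⁺(V'/F_∞)) = Char X(D) · Char X(Dη)`) with g2's §3 at `η`. CONDITIONAL on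
`hZ`, `h134`, the row hypotheses; closes nothing. [cite: Kobayashi2003, Thm. 1.2 (p. 2), Thm. 2.2 (p. 5), Thm. 4.1 (p. 8), last sentence of §7 (p. 13)]
[cite: Kato2004Asterisque, Thm. 13.4 (p. 226)] [cite: GreenbergLNM1716, §3 (descent; reading)] -/
theorem quadraticBranchPlusKatoDivisibilityAt_of_zeta_of_thm13_4_of_row
    (hZ : Kobayashi2003.thm62_63_73_etaColemanPoitouTate_zeta)
    (h134 : Kato2004.thm13_4_lengthAt_fineSelmerDual_le_of_isEulerSystemClass)
    (V : WeierstrassCurve ℚ) [V.IsElliptic] [V.IsGloballyMinimal] (hp5 : 5 ≤ p)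
    (hgood : V.HasGoodReductionAtPrime p) (hap : V.frobeniusTrace p = 0)
    (hv : ∀ [(V.quadraticTwist (((-1 : ℚ) ^ (p / 2)) * p)).IsElliptic],
      ∃ σ : absoluteGaloisGroup ℚ,
        (∀ (n : ℕ) (t : AlgebraicClosure ℚ), t ^ p ^ n = 1 → σ • t = t) ∧
          Module.finrank ℤ_[p]
            (((V.quadraticTwist (((-1 : ℚ) ^ (p / 2)) * p)).tateModule p) ⧸
              LinearMap.range
                ((V.quadraticTwist (((-1 : ℚ) ^ (p / 2)) * p)).galoisRepTate p σ - 1)) = 1)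
    (h12V : ∀ (κ : ZpExtension ℚ p) (γ : absoluteGaloisGroup ℚ), κ.IsCyclotomic → κ.IsTopGenerator γ →
      IsCyclotomicVariable p γ → ∀ {N : ℕ} [NeZero N] {f : CuspForm (Gamma0 N) 2}, IsNewformOf V f →
      ∀ D : Kobayashi2003.SignedSelmerDualData V κ γ 1,
        Module.Finite (IwasawaAlgebra p) D.X ∧ Module.IsTorsion (IwasawaAlgebra p) D.X) :
    QuadraticBranchPlusKatoDivisibilityAt V p := by
  have hp2 : p ≠ 2 := by omega
  haveI : NeZero p := ⟨(Fact.out : p.Prime).ne_zero⟩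
  haveI : IsCyclotomicExtension {p} ℚ (CyclotomicField p ℚ) :=
    CyclotomicField.isCyclotomicExtension p ℚ
  haveI : (galRange (K := ℚ) (CyclotomicField p ℚ)).Normal := normal_galRange_cyclotomic p _
  obtain ⟨θ, ηq, -, -, -, hηK, hη1⟩ := exists_theta_eta_cyclotomicField p hp2
  intro F _ _ V' _ κ γ κF γF N _ f hp2' hgood' hap' hF hθ hC hκ hγ hγc hκF hγF hζ hf ϖ hϖ Lη hL D DF
  obtain ⟨γ', hγ'K, hγ', hγ'c, Dη, ⟨e⟩⟩ :=
    exists_etaDatum_prod_linearEquiv_of_decomposition (CyclotomicField p ℚ) ηq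
      (fun κ₁ γ₁ hκ₁ hγ₁ hγ₁K hγ₁c F₁ _ _ V₁ _ κF₁ γF₁ hF₁ hθ₁ hC₁ hκF₁ hγF₁ hζ₁ =>
        etaDescentFrame_proof p hp5 (CyclotomicField p ℚ) ηq hηK hη1 V hgood hap κ₁ γ₁ hκ₁ hγ₁ hγ₁K
          hγ₁c F₁ V₁ κF₁ γF₁ hF₁ hθ₁ hC₁ hκF₁ hγF₁ hζ₁)
      F V' hF hθ hC hκ hγ hγc hκF hγF hζ D DF
  -- Thm. 1.2 for `D`, from the ROW hypothesis
  obtain ⟨hDfin, hDtor⟩ := h12V κ γ hκ hγ hγc hf D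
  -- Thm. 2.2 and Thm. 4.1 at `η` for `Dη`, from `{hZ, h134}` (g2's §3), through the Literature promotion
  -- copy of the `η`-object
  let Dη' : Kobayashi2003.EtaSignedSelmerDualData V κ (CyclotomicField p ℚ) ℚ_[p] ηq γ' 1 :=
    { X := Dη.X
      conj_mem := Dη.conj_mem
      toDual := Dη.toDual
      bijective := Dη.bijective
      toDual_T_smul := Dη.toDual_T_smul
      toDual_C_smul := Dη.toDual_C_smul }
  obtain ⟨hηfin, hηtor, ⟨n, hn⟩, hint⟩ :=
    EulerSystemBound.etaKatoDivisibility_of_zeta_of_thm13_4 hZ h134 (CyclotomicField p ℚ) ηq hηK hη1 V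
      hv hp2 hgood hap hf ϖ hϖ Lη hL κ γ' hκ hγ' hγ'K hγ'c Dη'
  -- the product is finitely generated torsion with `Char = Char D.X · Char Dη.X`
  haveI : Module.Finite (IwasawaAlgebra p) D.X := hDfin
  haveI : Module.Finite (IwasawaAlgebra p) Dη.X := hηfin
  haveI hPfin : Module.Finite (IwasawaAlgebra p) (D.X × Dη.X) := inferInstance
  have hPtor : Module.IsTorsion (IwasawaAlgebra p) (D.X × Dη.X) :=
    isTorsion_prod_of_isTorsion hDtor hηtor
  have hPchar : Module.charIdeal (IwasawaAlgebra p) (D.X × Dη.X) =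
      Module.charIdeal (IwasawaAlgebra p) D.X * Module.charIdeal (IwasawaAlgebra p) Dη.X :=
    charIdeal_mul_of_shortExact_holds p (D.X × Dη.X) hPtor
      (LinearMap.inl (IwasawaAlgebra p) D.X Dη.X) (LinearMap.snd (IwasawaAlgebra p) D.X Dη.X)
      LinearMap.inl_injective LinearMap.snd_surjective .inl_snd
  -- transport to `DF`
  have hfinF : Module.Finite (IwasawaAlgebra p) DF.X := Module.Finite.equiv e.symm
  have htorF : Module.IsTorsion (IwasawaAlgebra p) DF.X := by
    intro x
    obtain ⟨a, ha⟩ := @hPtor (e x)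
    refine ⟨a, ?_⟩
    rw [Submonoid.smul_def] at ha ⊢
    have h := congrArg e.symm ha
    rwa [map_smul, map_zero, LinearEquiv.symm_apply_apply] at h
  have hcharF : DF.charIdeal = D.charIdeal * Dη.charIdeal := by
    change Module.charIdeal (IwasawaAlgebra p) DF.X =
      Module.charIdeal (IwasawaAlgebra p) D.X * Module.charIdeal (IwasawaAlgebra p) Dη.X
    rw [Module.charIdeal_eq_of_linearEquiv e]
    exact hPchar
  refine ⟨hfinF, htorF, ⟨n, ?_⟩, fun hsurj => ?_⟩
  · rw [hcharF, mul_left_comm, Ideal.span_singleton_mul_span_singleton]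
    exact Ideal.mul_mono_right ((Ideal.span_singleton_le_iff_mem _).mpr hn)
  · rw [hcharF]
    exact Ideal.mul_mono_right ((Ideal.span_singleton_le_iff_mem _).mpr (hint hsurj))

/-- **(RK⁺) on a TOWER-ONTO row from `{hZ, hCK, h134, h5}`** — the `η`-package with Euler-system pin,
the `η = 1` Coleman/Kato package, Kato Thm. 13.4, the period unit — and NO Kobayashi theorem: Kato's (v)
for `V^{(p*)}` from tower surjectivity (`√p* ∈ ℚ(ζ_p)`), Thm. 1.2 on the row from
`finite_isTorsion_signedSelmerDual_of_colemanKato_onto`. CONDITIONAL on the four named facts; closes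
nothing. [cite: Kobayashi2003, Thm. 1.2 (p. 2), Thm. 4.1 (p. 8), Thm. 7.3 (p. 13)]
[cite: Kato2004Asterisque, (12.5.2) (p. 222) and Thm. 13.4 (p. 226)] -/
theorem quadraticBranchPlusKatoDivisibilityAt_of_colemanPackages_of_onto
    (hZ : Kobayashi2003.thm62_63_73_etaColemanPoitouTate_zeta)
    (hCK : Kobayashi2003.thm62_63_73_signedColemanKato_zeta)
    (h134 : Kato2004.thm13_4_lengthAt_fineSelmerDual_le_of_isEulerSystemClass)
    (h5 : realPeriodRat_eq_unit_mul_plusPeriod)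
    (V : WeierstrassCurve ℚ) [V.IsElliptic] [V.IsGloballyMinimal] (hp5 : 5 ≤ p)
    (hgood : V.HasGoodReductionAtPrime p) (hap : V.frobeniusTrace p = 0)
    (hsurj : ∀ m : ℕ, V.HasSurjectiveModNGaloisRep (p ^ m : ℕ)) :
    QuadraticBranchPlusKatoDivisibilityAt V p := by
  have hp2 : p ≠ 2 := by omega
  have hc : (((-1 : ℚ) ^ (p / 2)) * p) ≠ 0 :=
    mul_ne_zero (pow_ne_zero _ (by norm_num)) (Nat.cast_ne_zero.mpr (Fact.out : p.Prime).ne_zero)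
  refine quadraticBranchPlusKatoDivisibilityAt_of_zeta_of_thm13_4_of_row hZ h134 V hp5 hgood hap
    (fun {_} => ?_)
    fun κ γ hκ hγ hγc _ _ _ hf D =>
      finite_isTorsion_signedSelmerDual_of_colemanKato_onto hCK h134 h5 V hp5 hgood hap hsurj hf κ γ hκ
        hγ hγc 1 D
  obtain ⟨C, hC⟩ := exists_variableChange_twist_twist V hc
  exact Kato2004.exists_finrank_coker_eq_one_of_smul_eq_quadraticTwist_primeStar_of_forall_hasSurjectiveModNGaloisRep
    hp2 C hC hsurj

/-- **Item 19241 `PlusKatoDivisibilityBranch` RESTRICTED TO THE TOWER-ONTO ROWS, from the four named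
CONSTRUCTION-level facts `{hZ, hCK, h134, h5}` by name** — no Kobayashi theorem (1.2 / 2.2 / 4.1) is a
hypothesis: on exactly the rows where `closes` consumes `hK : PlusKatoDivisibilityBranch`, the decl
follows from two Coleman / Poitou–Tate packages with Euler-system pins (`η` and `1`), Kato's general
Euler-system bound, and the period unit. CONDITIONAL; the ∀-row decl (CM / non-onto rows) is NOT
claimed. [cite: Kobayashi2003, Thm. 4.1 (p. 8), Thm. 2.2 (p. 5), Thm. 1.2 (p. 2), §§6–7]
[cite: Kato2004Asterisque, Thm. 13.4 (p. 226)] [cite: GreenbergVatsal2000, §3, Remark 3.4] -/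
theorem plusKatoDivisibilityBranch_onto_of_colemanPackages
    (hZ : Kobayashi2003.thm62_63_73_etaColemanPoitouTate_zeta)
    (hCK : Kobayashi2003.thm62_63_73_signedColemanKato_zeta)
    (h134 : Kato2004.thm13_4_lengthAt_fineSelmerDual_le_of_isEulerSystemClass)
    (h5 : realPeriodRat_eq_unit_mul_plusPeriod) :
    ∀ (V : WeierstrassCurve ℚ) [V.IsElliptic] [V.IsGloballyMinimal] (p : ℕ) [Fact p.Prime], 5 ≤ p →
      V.HasGoodReductionAtPrime p → V.frobeniusTrace p = 0 →
      (∀ m : ℕ, V.HasSurjectiveModNGaloisRep (p ^ m : ℕ)) → QuadraticBranchPlusKatoDivisibilityAt V p :=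
  fun V _ _ _ _ hp5 hgood hap hsurj =>
    quadraticBranchPlusKatoDivisibilityAt_of_colemanPackages_of_onto hZ hCK h134 h5 V hp5 hgood hap hsurj

end RK

/-! ## §6 The rung leaf K8 `O5SharpGss` with the Kato side on Coleman packages only -/

/-- **The rung leaf K8 `O5SharpGss` from `{hZ, hCK, h134, h5}` + the route's OPEN cruxes and held
inputs** — g2's `o5SharpGss_of_facts_of_cruxes` with `h12` (Kobayashi Thm. 1.2) replaced by the `η = 1`
Coleman/Kato package `hCK` and the period unit `h5`: `closes` re-run (`EulerSystemBound.o5SharpGss_of_onto`)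
with `hK` = `plusKatoDivisibilityBranch_onto_of_colemanPackages`, `h₂` = `etaTransportSigned_of_zeta hZ`,
`hG` = `gss2Assembly_proof`. Hypotheses left: the open crux items `hE` (19242), `hN` (19243), `h₄`
(19116), the held published inputs `hP`, `hKO`, and the declared residual `hR` (19120). CONDITIONAL;
closes nothing; BSD for no curve. [cite: Kobayashi2003, §§6–7, Thm. 7.4 (p. 13)] [cite: Kato2004Asterisque, Thm. 13.4 (p. 226)]
[cite: KitajimaOtsuki2018, Main Thm. 1.3] -/
theorem o5SharpGss_of_colemanPackages_of_cruxes
    (hZ : Kobayashi2003.thm62_63_73_etaColemanPoitouTate_zeta)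
    (hCK : Kobayashi2003.thm62_63_73_signedColemanKato_zeta)
    (h134 : Kato2004.thm13_4_lengthAt_fineSelmerDual_le_of_isEulerSystemClass)
    (h5 : realPeriodRat_eq_unit_mul_plusPeriod)
    (hE : PlusLowerInclusionSurjBranch) (hN : PlusMainConjectureNonsurjBranch)
    (h₄ : PAdicGrossZagierBranch) (hP : PublishedInputsGss2) (hKO : PublishedInputKO13)
    (hR : Gss2AtThree) :
    Summit.BirchSwinnertonDyer.Rank1Residual.Additive.O5SharpGss :=
  EulerSystemBound.o5SharpGss_of_onto (plusKatoDivisibilityBranch_onto_of_colemanPackages hZ hCK h134 h5)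
    hE hN (EulerSystemBound.etaTransportSigned_of_zeta hZ) h₄ hP hKO gss2Assembly_proof hR

/-! ## §7 The second road: Thm. 1.2 from `{hCK, Kato (12.2.2), Kato 12.4 (1)∘(17.13.1), modularity}`,
class-wide; g2's onto chain, g2's leaf and g0's ∀-row item decl with `h12` discharged -/

/-- **g2's tower-onto chain with Kobayashi Thm. 1.2 DISCHARGED by the Literature theorem
`Kobayashi2003.thm12_signedSelmerDual_finite_torsion_of_colemanKato`**: the route decl restricted to the
tower-onto rows from `{hZ, h134}` + `{hCK, hH1, hYt, hmod}` — the `η`-package with Euler-system pin, Kato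
Thm. 13.4, the `η = 1` Coleman/Kato package, Kato (12.2.2), Kato 12.4 (1)∘(17.13.1), modularity.
CONDITIONAL; closes nothing. [cite: Kobayashi2003, Thm. 1.2 (p. 2), Thm. 7.3 (p. 13)] [cite: Kato2004Asterisque, §12.2 (12.2.2) (p. 220), Thm. 12.4 (p. 221), Thm. 13.4 (p. 226)] -/
theorem plusKatoDivisibilityBranch_onto_of_colemanKato_facts
    (hZ : Kobayashi2003.thm62_63_73_etaColemanPoitouTate_zeta)
    (h134 : Kato2004.thm13_4_lengthAt_fineSelmerDual_le_of_isEulerSystemClass)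
    (hCK : Kobayashi2003.thm62_63_73_signedColemanKato_zeta) (hH1 : Kato2004.one_le_rank_iwasawaH1)
    (hYt : Kato2004_fineSelmerDual_isTorsion) (hmod : exists_isNewformOf) :
    ∀ (V : WeierstrassCurve ℚ) [V.IsElliptic] [V.IsGloballyMinimal] (p : ℕ) [Fact p.Prime], 5 ≤ p →
      V.HasGoodReductionAtPrime p → V.frobeniusTrace p = 0 →
      (∀ m : ℕ, V.HasSurjectiveModNGaloisRep (p ^ m : ℕ)) → QuadraticBranchPlusKatoDivisibilityAt V p :=
  EulerSystemBound.plusKatoDivisibilityBranch_onto hZ h134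
    (Kobayashi2003.thm12_signedSelmerDual_finite_torsion_of_colemanKato hCK hH1 hYt hmod)

/-- **g2's leaf with Thm. 1.2 discharged**: the rung leaf K8 `O5SharpGss` from `{hZ, h134, hCK, hH1, hYt,
hmod}` + the open cruxes `hE` (19242), `hN` (19243), `h₄` (19116) + the held inputs `hP`, `hKO`, `hR`.
CONDITIONAL; closes nothing; BSD for no curve. [cite: Kobayashi2003, §§6–7 (pp. 11–13)] [cite: Kato2004Asterisque, §12.2, Thm. 12.4, Thm. 13.4]
[cite: KitajimaOtsuki2018, Main Thm. 1.3] -/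
theorem o5SharpGss_of_colemanKato_facts_of_cruxes
    (hZ : Kobayashi2003.thm62_63_73_etaColemanPoitouTate_zeta)
    (h134 : Kato2004.thm13_4_lengthAt_fineSelmerDual_le_of_isEulerSystemClass)
    (hCK : Kobayashi2003.thm62_63_73_signedColemanKato_zeta) (hH1 : Kato2004.one_le_rank_iwasawaH1)
    (hYt : Kato2004_fineSelmerDual_isTorsion) (hmod : exists_isNewformOf)
    (hE : PlusLowerInclusionSurjBranch) (hN : PlusMainConjectureNonsurjBranch)
    (h₄ : PAdicGrossZagierBranch) (hP : PublishedInputsGss2) (hKO : PublishedInputKO13)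
    (hR : Gss2AtThree) :
    Summit.BirchSwinnertonDyer.Rank1Residual.Additive.O5SharpGss :=
  EulerSystemBound.o5SharpGss_of_facts_of_cruxes hZ h134
    (Kobayashi2003.thm12_signedSelmerDual_finite_torsion_of_colemanKato hCK hH1 hYt hmod) hE hN h₄ hP hKO
    hR

/-- **The item decl `PlusKatoDivisibilityBranch` on ALL rows (CM and non-onto included) from packages
only**: g0's ∀-row derivation `plusKatoDivisibilityBranch_of_etaKatoColemanPoitouTate_of_thm12` (from the
`η`-package WITH Kato's Thm. 5.2 iii)–v) fields, `Kobayashi2003.thm52_62_63_73_etaKatoColemanPoitouTate`)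
with its second hypothesis Kobayashi Thm. 1.2 DISCHARGED by `{hCK, hH1, hYt, hmod}`. After this, no road
to item 19241 in the tree needs a Kobayashi THEOREM (1.2 / 2.2 / 4.1) as a named input: the inputs are
Coleman / Poitou–Tate construction packages (at `η` and at `1`), statements of Kato's §12–13, and
modularity. CONDITIONAL on the five named facts; the item stays settled-by-citation.
[cite: Kobayashi2003, Thm. 1.2 (p. 2), Thm. 4.1 (p. 8), Thm. 5.2 (p. 9), §§6–7 (pp. 11–13)]
[cite: Kato2004Asterisque, §12.2 (12.2.2) (p. 220), Thm. 12.4–12.6 (pp. 221–222), (17.13.1) (p. 279)] -/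
theorem plusKatoDivisibilityBranch_of_packages
    (hK52 : Kobayashi2003.thm52_62_63_73_etaKatoColemanPoitouTate)
    (hCK : Kobayashi2003.thm62_63_73_signedColemanKato_zeta) (hH1 : Kato2004.one_le_rank_iwasawaH1)
    (hYt : Kato2004_fineSelmerDual_isTorsion) (hmod : exists_isNewformOf) :
    PlusKatoDivisibilityBranch :=
  plusKatoDivisibilityBranch_of_etaKatoColemanPoitouTate_of_thm12 hK52
    (Kobayashi2003.thm12_signedSelmerDual_finite_torsion_of_colemanKato hCK hH1 hYt hmod)

end ColemanKatoTorsion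

end Summit.BirchSwinnertonDyer.BirchSwinnertonDyer.Theorems

end
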